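import Mathlib
import HarnessLib
import Literature.Analysis.SpecialFunctions.LogChooseStirling
import Summits.KontsevichZagierPeriods.Zeta5Search.Denom.TwoTaleP15Forms
import Summits.KontsevichZagierPeriods.Zeta5Search.TwoTaleP15Growth

/-!
# TwoTaleP15GrowthLimit — `log (qhat n) / n → C₁*`, `WhippleP15 → CoeffRate C₁*`, and the packaged P15 implication

HONEST FRAMING: systematic search; no irrationality claim unless certified.

fam-measure (pub-zeta5), `families/measure/FAMILY.md` §10.3 / §10.8.  Sequel of `TwoTaleP15Growth` (one development,
split for the 400-line cap; see the overview there).  THIS PART: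
* the LOWER bound at the near-critical index `k_n = ⌊ustar·n⌋` (`exp_le_taleTwoA_kcrit`: the tree's Stirling bound
  `log_choose_ge_entropy` plus `KL ≤ χ²`, `chernoff_sub_penalty_le_entropy`, turns the entropy into the affine
  Chernoff form minus the bounded penalty `penP + 2·log(33n) + 8`);
* **`tendsto_log_qhat_div`** (PROVED, unconditional): `log (qhat n) / n → C₁star`;
* **`coeffRate_of_whipple : WhippleP15 → CoeffRate C₁star`**, **`C₁star_pos`** (`C(10n,5n) ≤ (10n+1)·qhat n`);
* packaged (PROVED implications, the growth inputs `CoeffRate C₁`, `0 < C₁` of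
  `Denom.TwoTaleP15Forms.exponentLE_of_inputs` replaced by `WhippleP15`): `exponentLE_of_whipple`,
  `zetaTwo_exponent_le_of_whipple : Inclusion → Decay 29.10787 → WhippleP15 → C₁star ≤ 42.033616 →
  ExponentLE (zetaValue 2) 5.0496 ∧ Zudilin2014.zetaTwo_irrationalityExponent_le` and the robust
  `zetaTwo_exponent_le_of_whipple_robust : Inclusion → Decay 29.1 → WhippleP15 → C₁star ≤ 42.04 →
  ExponentLE (zetaValue 2) 5.0523 ∧ …` (the enclosure hypothesis is discharged in `TwoTaleP15GrowthEnclosure`).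

NOTHING here certifies a measure: `Inclusion`, `Decay` ((bmiss) at P15 + a line-integral bound, fam-denom's
`Denom/TwoTaleP15Decay`) and `WhippleP15` remain named inputs.
References: W. N. Bailey, Generalized hypergeometric series (1935) §4.5; W. Zudilin, arXiv:1310.1526 [Zudilin2014ZetaTwo]
§6, Remark 5; W. Zudilin, arXiv:1611.08806 §3 eq. (10)–(11).
-/

noncomputable section

open Filter Topology Finset Real

namespace Summit.KontsevichZagierPeriods.Zeta5Search.TwoTaleP15Growth

open Summit.KontsevichZagierPeriods.Zeta5Search.Denom.TwoTaleP15Forms (formQ formQ_one CoeffRate)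
open Literature.Analysis.SpecialFunctions (log_choose_le_entropy log_choose_ge_entropy)

/-! ### Lower bound for `qhat` at the near-critical index -/

/-- The near-critical index `k_n = ⌊u*·n⌋`. -/
def kcrit (n : ℕ) : ℕ := ⌊ustar * n⌋₊

/-- `k_n ≤ u*·n < k_n + 1`. -/
theorem kcrit_real (n : ℕ) : (kcrit n : ℝ) ≤ ustar * n ∧ ustar * n < kcrit n + 1 :=
  ⟨Nat.floor_le (by have := ustar_bounds.1; positivity), Nat.lt_floor_add_one _⟩

/-- `17n ≤ k_n < 24n` for `n ≥ 1` (from `17 ≤ u* ≤ 23.9`). -/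
theorem kcrit_range {n : ℕ} (hn : 1 ≤ n) : 17 * n ≤ kcrit n ∧ kcrit n < 24 * n := by
  have h1 := ustar_spec.1.1
  have h2 := ustar_spec.1.2
  have hn' : (1:ℝ) ≤ n := by exact_mod_cast hn
  constructor
  · apply Nat.le_floor
    push_cast
    nlinarith
  · unfold kcrit
    rw [Nat.floor_lt (by positivity)]
    push_cast
    nlinarith

/-- Penalty control: `(K − tN)²/(N t(1−t)) ≤ c₂/(t(1−t))` when `N ≥ 1` and `(K − tN)² ≤ c₂`. -/
theorem pen_le {K N t c₂ : ℝ} (hN : 1 ≤ N) (h0 : 0 < t) (h1 : t < 1) (hc : (K - t * N) ^ 2 ≤ c₂) :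
    (K - t * N) ^ 2 / (N * (t * (1 - t))) ≤ c₂ / (t * (1 - t)) := by
  have ht : 0 < t * (1 - t) := mul_pos h0 (by linarith)
  have hc2 : 0 ≤ c₂ := (sq_nonneg _).trans hc
  calc (K - t * N) ^ 2 / (N * (t * (1 - t))) ≤ c₂ / (N * (t * (1 - t))) :=
        div_le_div_of_nonneg_right hc (by positivity)
    _ ≤ c₂ / (t * (1 - t)) :=
        div_le_div_of_nonneg_left hc2 ht (le_mul_of_one_le_left ht.le hN)

/-- **Lower half**: the single summand at `k_n = ⌊u* n⌋` is within a bounded-times-polynomial factor of the tangent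
plane: `exp(n·C₁* + K₀(u*) − P − 2·log(33n) − 8) ≤ taleTwoA n k_n` for `n ≥ 1`. -/
theorem exp_le_taleTwoA_kcrit {n : ℕ} (hn : 1 ≤ n) :
    Real.exp (n * C₁star + constK ustar - penP - 2 * Real.log (33 * n) - 8) ≤ (taleTwoA n (kcrit n) : ℝ) := by
  obtain ⟨h17, h24⟩ := kcrit_range hn
  obtain ⟨hx0, hx1⟩ := kcrit_real n
  obtain ⟨hu1, hu2⟩ := ustar_bounds
  have h17u := ustar_spec.1.1
  have hG := ustar_spec.2
  obtain ⟨⟨a0, b0⟩, ⟨a1, b1⟩, ⟨a2, b2⟩, ⟨a3, b3⟩⟩ := slopes_mem hu1 hu2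
  set K := kcrit n with hKdef
  have hn' : (1:ℝ) ≤ n := by exact_mod_cast hn
  have hKR : (17:ℝ) * n ≤ K := by exact_mod_cast h17
  have hKR' : (K:ℝ) < 24 * n := by exact_mod_cast h24
  -- the four reverse-Chernoff bounds
  have g0 := exp_le_choose (N := 2 * K - (15 * n + 2)) (K := 17 * n) (by omega) (by omega) a0 b0
  have g1 := exp_le_choose (N := K - (6 * n + 1)) (K := 5 * n) (by omega) (by omega) a1 b1
  have g2 := exp_le_choose (N := 11 * n) (K := K - (13 * n + 1)) (by omega) (by omega) a2 b2
  have g3 := exp_le_choose (N := 11 * n) (K := K - (15 * n + 1)) (by omega) (by omega) a3 b3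
  have e0 : ((2 * K - (15 * n + 2) : ℕ) : ℝ) = 2 * K - 15 * n - 2 := by
    rw [Nat.cast_sub (by omega)]; push_cast; ring
  have e1 : ((K - (6 * n + 1) : ℕ) : ℝ) = K - 6 * n - 1 := by
    rw [Nat.cast_sub (by omega)]; push_cast; ring
  have e2 : ((K - (13 * n + 1) : ℕ) : ℝ) = K - 13 * n - 1 := by
    rw [Nat.cast_sub (by omega)]; push_cast; ring
  have e3 : ((K - (15 * n + 1) : ℕ) : ℝ) = K - 15 * n - 1 := by
    rw [Nat.cast_sub (by omega)]; push_cast; ring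
  rw [e0] at g0; rw [e1] at g1; rw [e2] at g2; rw [e3] at g3
  push_cast at g0 g1 g2 g3
  -- penalties are bounded
  have p0 : ((17 * n : ℝ) - t₀ ustar * (2 * K - 15 * n - 2)) ^ 2 / ((2 * K - 15 * n - 2) * (t₀ ustar * (1 - t₀ ustar)))
      ≤ 16 / (t₀ ustar * (1 - t₀ ustar)) := by
    refine pen_le (by linarith) a0 b0 ?_
    have h15 : (0:ℝ) < 2 * ustar - 15 := by linarith
    have e : (17 * n : ℝ) - t₀ ustar * (2 * K - 15 * n - 2) = 17 * (2 * (ustar * n - K) + 2) / (2 * ustar - 15) := by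
      unfold t₀; field_simp; ring
    rw [e]
    have hx : 0 ≤ 17 * (2 * (ustar * n - K) + 2) / (2 * ustar - 15) := div_nonneg (by linarith) h15.le
    have hx' : 17 * (2 * (ustar * n - K) + 2) / (2 * ustar - 15) ≤ 4 := by
      rw [div_le_iff₀ h15]; linarith
    exact (pow_le_pow_left₀ hx hx' 2).trans (by norm_num)
  have p1 : ((5 * n : ℝ) - t₁ ustar * (K - 6 * n - 1)) ^ 2 / ((K - 6 * n - 1) * (t₁ ustar * (1 - t₁ ustar)))
      ≤ 1 / (t₁ ustar * (1 - t₁ ustar)) := by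
    refine pen_le (by linarith) a1 b1 ?_
    have h6 : (0:ℝ) < ustar - 6 := by linarith
    have e : (5 * n : ℝ) - t₁ ustar * (K - 6 * n - 1) = 5 * ((ustar * n - K) + 1) / (ustar - 6) := by
      unfold t₁; field_simp; ring
    rw [e]
    have hx : 0 ≤ 5 * ((ustar * n - K) + 1) / (ustar - 6) := div_nonneg (by linarith) h6.le
    have hx' : 5 * ((ustar * n - K) + 1) / (ustar - 6) ≤ 1 := by
      rw [div_le_iff₀ h6]; linarith
    exact (pow_le_pow_left₀ hx hx' 2).trans (by norm_num)
  have p2 : ((K - 13 * n - 1 : ℝ) - t₂ ustar * (11 * n)) ^ 2 / ((11 * n) * (t₂ ustar * (1 - t₂ ustar)))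
      ≤ 4 / (t₂ ustar * (1 - t₂ ustar)) := by
    refine pen_le (by linarith) a2 b2 ?_
    have e : (K - 13 * n - 1 : ℝ) - t₂ ustar * (11 * n) = (K - ustar * n) - 1 := by
      unfold t₂; field_simp; ring
    rw [e]
    have hx : (K - ustar * n : ℝ) - 1 ≤ 2 := by linarith
    have hx' : -2 ≤ (K - ustar * n : ℝ) - 1 := by linarith
    exact (sq_le_sq' hx' hx).trans (by norm_num)
  have p3 : ((K - 15 * n - 1 : ℝ) - t₃ ustar * (11 * n)) ^ 2 / ((11 * n) * (t₃ ustar * (1 - t₃ ustar)))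
      ≤ 4 / (t₃ ustar * (1 - t₃ ustar)) := by
    refine pen_le (by linarith) a3 b3 ?_
    have e : (K - 15 * n - 1 : ℝ) - t₃ ustar * (11 * n) = (K - ustar * n) - 1 := by
      unfold t₃; field_simp; ring
    rw [e]
    have hx : (K - ustar * n : ℝ) - 1 ≤ 2 := by linarith
    have hx' : -2 ≤ (K - ustar * n : ℝ) - 1 := by linarith
    exact (sq_le_sq' hx' hx).trans (by norm_num)
  -- logarithms of the block sizes
  have hl : ∀ x : ℝ, 1 ≤ x → x ≤ 33 * n → Real.log x ≤ Real.log (33 * n) := fun x hx hx' =>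
    Real.log_le_log (by linarith) hx'
  have l0 := hl (2 * K - 15 * n - 2) (by linarith) (by linarith)
  have l1 := hl (K - 6 * n - 1) (by linarith) (by linarith)
  have l2 := hl (11 * n) (by linarith) (by linarith)
  -- assemble
  have hsum := affine_eq ustar (n : ℝ) (K : ℝ)
  rw [hG, mul_zero, add_zero] at hsum
  have hprod := prod4_le (Real.exp_pos _).le (Real.exp_pos _).le (Real.exp_pos _).le (Real.exp_pos _).le g0 g1 g2 g3
  rw [← Real.exp_add, ← Real.exp_add, ← Real.exp_add] at hprod
  have hcast : (taleTwoA n K : ℝ) = ((2 * K - (15 * n + 2)).choose (17 * n) : ℝ) * ((K - (6 * n + 1)).choose (5 * n) : ℝ) *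
      ((11 * n).choose (K - (13 * n + 1)) : ℝ) * ((11 * n).choose (K - (15 * n + 1)) : ℝ) := by
    unfold taleTwoA; push_cast; ring
  rw [hcast]
  refine le_trans (Real.exp_le_exp.mpr ?_) hprod
  unfold C₁star penP
  linarith [hsum, p0, p1, p2, p3, l0, l1, l2]

/-- `qhat n` dominates the near-critical summand (`n ≥ 1`). -/
theorem taleTwoA_kcrit_le_qhat {n : ℕ} (hn : 1 ≤ n) : taleTwoA n (kcrit n) ≤ qhat n := by
  obtain ⟨h17, h24⟩ := kcrit_range hn
  unfold qhat
  exact Finset.single_le_sum (f := fun k => taleTwoA n k) (fun _ _ => Nat.zero_le _)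
    (Finset.mem_Ico.mpr ⟨by omega, by omega⟩)

/-- **Two-sided bounds** for `log (qhat n)`, `n ≥ 1`. -/
theorem log_qhat_bounds {n : ℕ} (hn : 1 ≤ n) :
    n * C₁star + constK ustar - penP - 2 * Real.log (33 * n) - 8 ≤ Real.log (qhat n) ∧
      Real.log (qhat n) ≤ n * C₁star + constK ustar + Real.log (11 * n + 1) := by
  have hlo := (exp_le_taleTwoA_kcrit hn).trans (by exact_mod_cast taleTwoA_kcrit_le_qhat hn :
    (taleTwoA n (kcrit n) : ℝ) ≤ qhat n)
  have hq : (0 : ℝ) < qhat n := (Real.exp_pos _).trans_le hlo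
  constructor
  · have := Real.log_le_log (Real.exp_pos _) hlo
    rwa [Real.log_exp] at this
  · have h := Real.log_le_log hq (qhat_le n)
    have hpos : (0:ℝ) < 11 * n + 1 := by positivity
    rw [Real.log_mul hpos.ne' (Real.exp_pos _).ne', Real.log_exp] at h
    linarith

/-! ### The limit -/

/-- `log(a·n + b)/n → 0` along `ℕ` for `a ≥ 1`, `b ≥ 0`. -/
theorem tendsto_log_linear_div {a b : ℝ} (ha : 1 ≤ a) (hb : 0 ≤ b) :
    Tendsto (fun n : ℕ => Real.log (a * n + b) / n) atTop (𝓝 0) := by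
  have hlog : Tendsto (fun n : ℕ => Real.log (n : ℝ) / n) atTop (𝓝 0) :=
    (Real.isLittleO_log_id_atTop.tendsto_div_nhds_zero).comp tendsto_natCast_atTop_atTop
  have hc : Tendsto (fun n : ℕ => Real.log (a + b) / n) atTop (𝓝 0) := tendsto_const_div_atTop_nhds_zero_nat _
  have hsum : Tendsto (fun n : ℕ => Real.log (a + b) / n + Real.log (n : ℝ) / n) atTop (𝓝 0) := by
    simpa using hc.add hlog
  refine tendsto_of_tendsto_of_tendsto_of_le_of_le' tendsto_const_nhds hsum ?_ ?_
  · filter_upwards [eventually_ge_atTop 1] with n hn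
    have hn' : (1:ℝ) ≤ n := by exact_mod_cast hn
    exact div_nonneg (Real.log_nonneg (by nlinarith)) (by positivity)
  · filter_upwards [eventually_ge_atTop 1] with n hn
    have hn' : (1:ℝ) ≤ n := by exact_mod_cast hn
    have hnpos : (0:ℝ) < n := by positivity
    rw [← add_div]
    apply div_le_div_of_nonneg_right _ hnpos.le
    rw [← Real.log_mul (by positivity) hnpos.ne']
    exact Real.log_le_log (by nlinarith) (by nlinarith)

/-- **THE COEFFICIENT RATE EXISTS (unconditionally, for the partner sum):** `log (qhat n) / n → C₁*`. -/
theorem tendsto_log_qhat_div : Tendsto (fun n : ℕ => Real.log (qhat n) / n) atTop (𝓝 C₁star) := by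
  have hA : Tendsto (fun n : ℕ => (constK ustar - penP - 8) / (n : ℝ)) atTop (𝓝 0) :=
    tendsto_const_div_atTop_nhds_zero_nat _
  have hB : Tendsto (fun n : ℕ => Real.log (33 * n + 0) / (n : ℝ)) atTop (𝓝 0) :=
    tendsto_log_linear_div (by norm_num) le_rfl
  have hC : Tendsto (fun n : ℕ => (constK ustar) / (n : ℝ)) atTop (𝓝 0) :=
    tendsto_const_div_atTop_nhds_zero_nat _
  have hD : Tendsto (fun n : ℕ => Real.log (11 * n + 1) / (n : ℝ)) atTop (𝓝 0) :=
    tendsto_log_linear_div (by norm_num) (by norm_num)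
  have hlo : Tendsto (fun n : ℕ => C₁star + ((constK ustar - penP - 8) / (n : ℝ) - 2 * (Real.log (33 * n + 0) / n)))
      atTop (𝓝 C₁star) := by
    simpa using tendsto_const_nhds.add (hA.sub (hB.const_mul 2))
  have hhi : Tendsto (fun n : ℕ => C₁star + ((constK ustar) / (n : ℝ) + Real.log (11 * n + 1) / n))
      atTop (𝓝 C₁star) := by
    simpa using tendsto_const_nhds.add (hC.add hD)
  refine tendsto_of_tendsto_of_tendsto_of_le_of_le' hlo hhi ?_ ?_
  · filter_upwards [eventually_ge_atTop 1] with n hn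
    have hnpos : (0:ℝ) < n := by exact_mod_cast hn
    have h := (log_qhat_bounds hn).1
    rw [add_zero]
    have e : C₁star + ((constK ustar - penP - 8) / (n : ℝ) - 2 * (Real.log (33 * n) / n)) =
        (n * C₁star + constK ustar - penP - 2 * Real.log (33 * n) - 8) / n := by
      field_simp; ring
    rw [e]
    exact div_le_div_of_nonneg_right h hnpos.le
  · filter_upwards [eventually_ge_atTop 1] with n hn
    have hnpos : (0:ℝ) < n := by exact_mod_cast hn
    have h := (log_qhat_bounds hn).2
    have e : C₁star + ((constK ustar) / (n : ℝ) + Real.log (11 * n + 1) / n) =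
        (n * C₁star + constK ustar + Real.log (11 * n + 1)) / n := by
      field_simp; ring
    rw [e]
    exact div_le_div_of_nonneg_right h hnpos.le

/-- **`CoeffRate C₁*` from Whipple.** -/
theorem coeffRate_of_whipple (hW : WhippleP15) : CoeffRate C₁star := by
  unfold CoeffRate
  refine tendsto_log_qhat_div.congr' ?_
  filter_upwards [eventually_ge_atTop 1] with n hn
  rw [hW n hn]
  push_cast
  rw [abs_neg, abs_of_nonneg (Nat.cast_nonneg _)]

/-! ### Positivity of the rate -/

/-- A crude lower bound: `4^{5n} ≤ (10n+1)·qhat n` (the summand at `k = 16n+1` contains `C(10n, 5n)`). -/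
theorem four_pow_le_qhat {n : ℕ} (hn : 1 ≤ n) : 4 ^ (5 * n) ≤ (10 * n + 1) * qhat n := by
  have hk : taleTwoA n (16 * n + 1) ≤ qhat n := by
    unfold qhat
    exact Finset.single_le_sum (f := fun k => taleTwoA n k) (fun _ _ => Nat.zero_le _)
      (Finset.mem_Ico.mpr ⟨by omega, by omega⟩)
  have hA : Nat.centralBinom (5 * n) ≤ taleTwoA n (16 * n + 1) := by
    unfold taleTwoA
    have e1 : 2 * (16 * n + 1) - (15 * n + 2) = 17 * n := by omega
    have e2 : 16 * n + 1 - (6 * n + 1) = 10 * n := by omega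
    have e3 : 16 * n + 1 - (13 * n + 1) = 3 * n := by omega
    have e4 : 16 * n + 1 - (15 * n + 1) = n := by omega
    rw [e1, e2, e3, e4, Nat.choose_self, one_mul, Nat.centralBinom_eq_two_mul_choose,
      show 2 * (5 * n) = 10 * n by ring]
    have h3 : 1 ≤ (11 * n).choose (3 * n) := Nat.choose_pos (by omega)
    have h4 : 1 ≤ (11 * n).choose n := Nat.choose_pos (by omega)
    calc (10 * n).choose (5 * n) = (10 * n).choose (5 * n) * 1 * 1 := by ring
      _ ≤ (10 * n).choose (5 * n) * (11 * n).choose (3 * n) * (11 * n).choose n := by gcongr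
  have hc := Nat.four_pow_le_two_mul_self_mul_centralBinom (5 * n) (by omega)
  calc 4 ^ (5 * n) ≤ 2 * (5 * n) * Nat.centralBinom (5 * n) := hc
    _ ≤ (10 * n + 1) * qhat n := by
        apply Nat.mul_le_mul (by omega) (hA.trans hk)

/-- **`C₁* > 0`** (indeed `C₁* ≥ 5 log 4`). -/
theorem C₁star_pos : 0 < C₁star := by
  have hlow : Tendsto (fun n : ℕ => 5 * Real.log 4 - Real.log (10 * n + 1) / n) atTop (𝓝 (5 * Real.log 4)) := by
    simpa using tendsto_const_nhds.sub (tendsto_log_linear_div (a := 10) (b := 1) (by norm_num) (by norm_num))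
  have hle : 5 * Real.log 4 ≤ C₁star := by
    refine le_of_tendsto_of_tendsto hlow tendsto_log_qhat_div ?_
    filter_upwards [eventually_ge_atTop 1] with n hn
    have h := four_pow_le_qhat hn
    have hq : 0 < qhat n := by
      rcases Nat.eq_zero_or_pos (qhat n) with h0 | h0
      · rw [h0, mul_zero] at h
        have := Nat.one_le_pow (5 * n) 4 (by norm_num)
        omega
      · exact h0
    have hR : (4:ℝ) ^ (5 * n) ≤ (10 * n + 1) * (qhat n : ℝ) := by exact_mod_cast h
    have hq' : (0:ℝ) < qhat n := by exact_mod_cast hq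
    have hlog := Real.log_le_log (by positivity) hR
    rw [Real.log_pow, Real.log_mul (by positivity) hq'.ne'] at hlog
    have hnpos : (0:ℝ) < n := by exact_mod_cast hn
    push_cast at hlog
    rw [sub_le_iff_le_add, ← add_div, le_div_iff₀ hnpos]
    linarith
  exact lt_of_lt_of_le (mul_pos (by norm_num) (Real.log_pos (by norm_num))) hle

/-! ### Packaged: the P15 measure implication with the growth input discharged by Whipple

`CoeffRate C₁` and `0 < C₁` are no longer inputs of the fam-denom assembly
(`Denom.TwoTaleP15Forms.exponentLE_of_inputs`): they are replaced by the single binomial identity `WhippleP15`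
(and, for a numerical exponent, an enclosure of the closed-form constant `C₁* = rateΛ ustar`, not proved here). -/

section Packaged

open Literature.NumberTheory.Irrationality
open Literature.NumberTheory.Transcendental (zetaValue)
open Summit.KontsevichZagierPeriods.Zeta5Search.Denom.TwoTaleP15Saving (savingRate savingRate_bounds)
open Summit.KontsevichZagierPeriods.Zeta5Search.Denom.TwoTaleP15Forms (Inclusion Decay exponentLE_of_inputs
  zetaTwo_exponent_le_of_inputs)

/-- **Generic measure from (Inclusion, Decay c, Whipple).** -/
theorem exponentLE_of_whipple {c : ℝ} (hI : Inclusion) (hD : Decay c) (hW : WhippleP15)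
    (hc : 31 - savingRate < c) :
    ExponentLE (zetaValue 2) (1 + (C₁star + (31 - savingRate)) / (c - (31 - savingRate))) :=
  exponentLE_of_inputs hI hD (coeffRate_of_whipple hW) hc C₁star_pos

/-- **The P15 record implication** of `Denom.TwoTaleP15Forms.zetaTwo_exponent_le_of_inputs` with `CoeffRate`,
`0 < C₁` replaced by `WhippleP15` and the enclosure `C₁* ≤ 42.033616` (numerically `C₁* = 42.03361581…`; the
enclosure is an honest remaining input — a digits task over `log 2, log 3, …`, margin `1.9e-7`). -/
theorem zetaTwo_exponent_le_of_whipple (hI : Inclusion) (hD : Decay 29.10787) (hW : WhippleP15)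
    (hC₁ : C₁star ≤ 42.033616) :
    ExponentLE (zetaValue 2) 5.0496 ∧ Zudilin2014.zetaTwo_irrationalityExponent_le :=
  zetaTwo_exponent_le_of_inputs hI hD (coeffRate_of_whipple hW) C₁star_pos hC₁

/-- **Robust variant** (the margins recommended in `families/measure/FAMILY.md` v1.4 §10.2): decay constant `29.1`
(`7.9e-3` below `C₀ = 29.10787127…`) and the coarse enclosure `C₁* ≤ 42.04` (`6.4e-3` above `C₁*`) still beat the
2014 record: `μ(ζ(2)) ≤ 5.0523 < 5.09541178`. -/
theorem zetaTwo_exponent_le_of_whipple_robust (hI : Inclusion) (hD : Decay 29.1) (hW : WhippleP15)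
    (hC₁ : C₁star ≤ 42.04) :
    ExponentLE (zetaValue 2) 5.0523 ∧ Zudilin2014.zetaTwo_irrationalityExponent_le := by
  have hS := savingRate_bounds
  have h := exponentLE_of_whipple hI hD hW (by linarith [hS.1])
  have hden : 0 < 29.1 - (31 - savingRate) := by linarith [hS.1]
  have hle : 1 + (C₁star + (31 - savingRate)) / (29.1 - (31 - savingRate)) ≤ 5.0523 := by
    have h1 : (C₁star + (31 - savingRate)) / (29.1 - (31 - savingRate)) ≤ 4.0523 := by
      rw [div_le_iff₀ hden]; nlinarith [hS.1]
    linarith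
  have h' : ExponentLE (zetaValue 2) 5.0523 := h.mono hle
  exact ⟨h', (zetaTwo_record_of_exponentLE h' (by norm_num)).1⟩

end Packaged

end Summit.KontsevichZagierPeriods.Zeta5Search.TwoTaleP15Growth

end
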